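import Literature.NumberTheory.EllipticCurves.ZpExtensionEisensteinDVRSettingH4ExactRepProofs
import Literature.NumberTheory.EllipticCurves.ZpExtensionEisensteinDVRSettingH4ReadingsBothProofs
import Literature.NumberTheory.EllipticCurves.ZpExtensionEisensteinDVRSettingH4TransferAdjointLeftProofs
import HarnessLib

/-!
# H.4 at the places `v ∣ p` for the curve's Eisenstein setting, XIV: (EXACT-REP) INSTANTIATED, `X`-side — a compatible family of
# `H¹(K_v, T^{(•)})` orthogonal at level `k` to the saturated families of `H¹(K_v, Tw T^{(•)})` is `p^{k+1} x″` up to a family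
# orthogonal to them at EVERY level

`Proofs` file (theorems only; no definition, no named fact, no instance, no `sorry`).  The `X`/`Y`-flipped twin of
`ZpExtensionEisensteinDVRSettingH4ExactRepProofs` (x9-p1-w2): x9-p1-w2's generic `Tower.exists_sub_pow_smul_forall_pairing_eq_zero`
applied to the flipped pairings `B_j.flip : Y_j × X_j → Q_j` of the `D`-indexed local towers `X_j = H¹(K_v, T^{(j)})`,
`Y_j = H¹(K_v, Tw T^{(j)})`, `Q_j = H²(K_v, A_{m,j+1}(1))` at a finite place `v` (ANY H.4 data `D j` satisfying `he_red`, the Poitou–Tate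
named fact), the side-dependent inputs being the left reading adjoint, the `Λ`-semilinearity of `H¹(Tw red)`, the exactness of the
twisted tower (`…H4LimitExactProofs`, by transport), x9-p1-w4's readings with both onto adjoints (`…H4ReadingsBothProofs`) and mirror
projection formula (`…H4TransferAdjointLeftProofs`), and §1's `Λ`-semilinearity of `H¹(Tw red)`.

* `eisensteinTower_red_scalarMapH1_twist` — `H¹(Tw red_j) ∘ H¹(c ·) = H¹(reduce c ·) ∘ H¹(Tw red_j)` (cell currency);

* **`eisensteinTower_exists_sub_pow_smul_forall_localCup_flip_eq_zero`** — for cores `C′_j ≤ Y_j` stable under `H¹(c ·)`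
  (`c ∈ A_{m,j+1}`), `ξ ∈ lim_j X_j` with `ξ_k ∪ η_k = 0` for all saturated `η`: `∃ x″ ∈ lim_j X_j, ∀ j, ∀ η` saturated,
  `(ξ_j − p^{k+1} x″_j) ∪ η_j = 0`.

With x9-p1-w4's (ANN-SAT, `X`-side) this is the `X`-side exactness clause `hExactX` of `Stmt.exactAtP`.  Cell `pub/bsd-print-x9` (STUB A
`hfin4` at `v ∣ p`).  No summit statement is proved here; BSD is not proved by any of this.  References: [Howard2004HeegnerKolyvagin]
Def. 1.1.1–1.1.3, §1.3 H.4, §1.6, Lemma 3.2.7 (arXiv:1202.6340 p. 5, p. 7 L78–82, p. 11–12, p. 16); [MilneADT2006] I Cor. 2.3;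
[SerreGaloisCohomology1997] I §2.2, II §5.
-/

set_option autoImplicit false

noncomputable section

open Function NumberField IsDedekindDomain Field CategoryTheory
open scoped NumberField ContRepresentation

namespace WeierstrassCurve

open Literature.NumberTheory.EllipticCurves Literature.NumberTheory.GaloisRepresentations
open Literature.NumberTheory.GaloisRepresentations.DiscreteGaloisModule
open Literature.NumberTheory.GaloisCohomology Literature.NumberTheory.GaloisCohomology.Howard2004
open Literature.NumberTheory.EllipticCurves.ZpExtension (EisensteinLevel)

variable {K : Type} [Field K] [NumberField K] (W : WeierstrassCurve ℚ) [W.IsElliptic] {p : ℕ} [hp : Fact p.Prime]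
  (κ : ZpExtension K p) {m : ℕ} (hm : 1 ≤ m) (cd : ConjugationDatum K)
  (D : letI := IwasawaAlgebra.isLocalRing_quotient_X_pow_add_C p hm
    ∀ k, DualityDatum p cd ((W.eisensteinTower κ hm).ρ k) (IwasawaAlgebra.EisensteinCoeff p m (k + 1)))
  (he_red : letI := IwasawaAlgebra.isLocalRing_quotient_X_pow_add_C p hm
    ∀ k (x y : EisensteinLevel p m (fun j ↦ geomTorsion (W.baseChange K) ((p : ℤ) ^ j)) (k + 1 + 1)),
      IwasawaAlgebra.EisensteinCoeff.reduce p m (Nat.le_succ (k + 1)) ((D (k + 1)).e x y) =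
        (D k).e ((W.eisensteinTower κ hm).red k x) ((W.eisensteinTower κ hm).red k y))

/-! ## §1 `H¹(Tw red)` is semilinear over `reduce` (cell currency) -/

/-- **`H¹(Tw red_j) (H¹(c ·) y) = H¹(reduce c ·) (H¹(Tw red_j) y)`** on `H¹(K_v, Tw T^{(j+1)}) → H¹(K_v, Tw T^{(j)})` for
`c ∈ A_{m,j+2}` (twisted companion of `eisensteinTower_red_scalarMapH1`; on cocycles).
[cite: Howard2004HeegnerKolyvagin, Def. 1.1.1, Def. 1.1.3 and §1.3 (Tw)] [cite: SerreGaloisCohomology1997, Ch. I §2.2 and §5.1] -/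
theorem eisensteinTower_red_scalarMapH1_twist (v : Place K) (j : ℕ) (c : IwasawaAlgebra.EisensteinCoeff p m (j + 1 + 1))
    (y : letI := IwasawaAlgebra.isLocalRing_quotient_X_pow_add_C p hm
      galoisCohomology ((cd.twist ((W.eisensteinTower κ hm).ρ (j + 1))).toLocal v) 1) :
    letI := IwasawaAlgebra.isLocalRing_quotient_X_pow_add_C p hm
    ContinuousRep.cohomologyMap ((cd.twist ((W.eisensteinTower κ hm).ρ (j + 1))).toLocal v)
        ((cd.twist ((W.eisensteinTower κ hm).ρ j)).toLocal v)
        ((W.eisensteinTower κ hm).red j).toAddMonoidHom continuous_of_discreteTopology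
        (fun _ z => (W.eisensteinTower κ hm).red_equivariant j _ z) 1
        (galoisCohomology.scalarMapH1 ((cd.twist ((W.eisensteinTower κ hm).ρ (j + 1))).toLocal v)
          (DualityDatum.isScalarLinear_twist_toLocal cd
            (κ.isScalarLinear_eisensteinAdicTowerSucc_coeff (fun j ↦ (W.baseChange K).torsionGaloisModule ((p : ℤ) ^ j))
              (fun j ↦ (W.baseChange K).torsionGaloisModuleReduce p j) hm
              (fun j ↦ (W.baseChange K).torsionGaloisModuleReduce_surjective p j) (j + 1)) v) c y) =
      galoisCohomology.scalarMapH1 ((cd.twist ((W.eisensteinTower κ hm).ρ j)).toLocal v)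
        (DualityDatum.isScalarLinear_twist_toLocal cd
          (κ.isScalarLinear_eisensteinAdicTowerSucc_coeff (fun j ↦ (W.baseChange K).torsionGaloisModule ((p : ℤ) ^ j))
            (fun j ↦ (W.baseChange K).torsionGaloisModuleReduce p j) hm
            (fun j ↦ (W.baseChange K).torsionGaloisModuleReduce_surjective p j) j) v)
        (IwasawaAlgebra.EisensteinCoeff.reduce p m (Nat.le_succ (j + 1)) c)
        (ContinuousRep.cohomologyMap ((cd.twist ((W.eisensteinTower κ hm).ρ (j + 1))).toLocal v)
          ((cd.twist ((W.eisensteinTower κ hm).ρ j)).toLocal v)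
          ((W.eisensteinTower κ hm).red j).toAddMonoidHom continuous_of_discreteTopology
          (fun _ z => (W.eisensteinTower κ hm).red_equivariant j _ z) 1 y) := by
  letI := IwasawaAlgebra.isLocalRing_quotient_X_pow_add_C p hm
  obtain ⟨c', rfl⟩ := oneCocycleClass_surjective _ y
  rw [galoisCohomology.scalarMapH1_oneCocycleClass]
  change ContinuousCohomology.map _ _ 1 (oneCocycleClass _ _) =
    galoisCohomology.scalarMapH1 _ _ _ (ContinuousCohomology.map _ _ 1 (oneCocycleClass _ c'))
  rw [map_oneCocycleClass, map_oneCocycleClass, galoisCohomology.scalarMapH1_oneCocycleClass]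
  congr 1
  refine Subtype.ext (ContinuousMap.ext fun σ ↦ ?_)
  exact W.eisensteinTower_red_smul κ hm j c (c'.1 σ)

/-! ## §2 (EXACT-REP) instantiated, `X`-side -/

include he_red in
set_option maxHeartbeats 1600000 in
/-- **(EXACT-REP) for the curve's Eisenstein setting at a finite place `v`, `X`-side.**  For ANY H.4 data `D j` over `A_{m,j+1}`
satisfying `he_red`, cores `C′_j ≤ H¹(K_v, Tw T^{(j)})` stable under the scalar action `H¹(c ·)` of `A_{m,j+1}`, a level `k` and a
compatible family `ξ` of `(H¹(K_v, T^{(j)}))_j` with `ξ_k ∪_k η_k = 0` for every saturated family `η` of the cores: there is a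
compatible family `x″` with `(ξ_j − p^{k+1} x″_j) ∪_j η_j = 0` for every `j` and every saturated `η` — given the Poitou–Tate named fact.
[cite: Howard2004HeegnerKolyvagin, §1.3 H.4 (arXiv p. 7, L78–82), Def. 1.1.1–1.1.3, §1.6, Lemma 3.2.7] [cite: MilneADT2006, Ch. I, Cor. 2.3] -/
theorem eisensteinTower_exists_sub_pow_smul_forall_localCup_flip_eq_zero (hPT : poitouTate_selmerStructure_duality K)
    (v : HeightOneSpectrum (𝓞 K))
    (C' : letI := IwasawaAlgebra.isLocalRing_quotient_X_pow_add_C p hm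
      ∀ j, AddSubgroup (galoisCohomology ((cd.twist ((W.eisensteinTower κ hm).ρ j)).toLocal (Sum.inr v)) 1))
    (hC' : letI := IwasawaAlgebra.isLocalRing_quotient_X_pow_add_C p hm
      ∀ (j : ℕ) (c : IwasawaAlgebra.EisensteinCoeff p m (j + 1))
        (y : galoisCohomology ((cd.twist ((W.eisensteinTower κ hm).ρ j)).toLocal (Sum.inr v)) 1), y ∈ C' j →
        galoisCohomology.scalarMapH1 ((cd.twist ((W.eisensteinTower κ hm).ρ j)).toLocal (Sum.inr v))
          (DualityDatum.isScalarLinear_twist_toLocal cd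
            (κ.isScalarLinear_eisensteinAdicTowerSucc_coeff (fun j ↦ (W.baseChange K).torsionGaloisModule ((p : ℤ) ^ j))
              (fun j ↦ (W.baseChange K).torsionGaloisModuleReduce p j) hm
              (fun j ↦ (W.baseChange K).torsionGaloisModuleReduce_surjective p j) j) (Sum.inr v)) c y ∈ C' j)
    (k : ℕ)
    {ξ : Π j, letI := IwasawaAlgebra.isLocalRing_quotient_X_pow_add_C p hm
      galoisCohomology (((W.eisensteinTower κ hm).ρ j).toLocal (Sum.inr v)) 1}
    (hξ : letI := IwasawaAlgebra.isLocalRing_quotient_X_pow_add_C p hm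
      ξ ∈ Tower.compatibleFamilies (H := fun j ↦ galoisCohomology (((W.eisensteinTower κ hm).ρ j).toLocal (Sum.inr v)) 1)
        (fun j ↦ ContinuousRep.cohomologyMap (((W.eisensteinTower κ hm).ρ (j + 1)).toLocal (Sum.inr v))
          (((W.eisensteinTower κ hm).ρ j).toLocal (Sum.inr v)) ((W.eisensteinTower κ hm).red j).toAddMonoidHom
          continuous_of_discreteTopology (fun _ z => (W.eisensteinTower κ hm).red_equivariant j _ z) 1))
    (hξ0 : letI := IwasawaAlgebra.isLocalRing_quotient_X_pow_add_C p hm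
      ∀ η ∈ Tower.saturatedFamilies
          (H := fun j ↦ galoisCohomology ((cd.twist ((W.eisensteinTower κ hm).ρ j)).toLocal (Sum.inr v)) 1)
          (fun j ↦ ContinuousRep.cohomologyMap ((cd.twist ((W.eisensteinTower κ hm).ρ (j + 1))).toLocal (Sum.inr v))
            ((cd.twist ((W.eisensteinTower κ hm).ρ j)).toLocal (Sum.inr v)) ((W.eisensteinTower κ hm).red j).toAddMonoidHom
            continuous_of_discreteTopology (fun _ z => (W.eisensteinTower κ hm).red_equivariant j _ z) 1) p C',
        (D k).localCup (Sum.inr v) (ξ k) (η k) = 0) :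
    letI := IwasawaAlgebra.isLocalRing_quotient_X_pow_add_C p hm
    ∃ x'' ∈ Tower.compatibleFamilies (H := fun j ↦ galoisCohomology (((W.eisensteinTower κ hm).ρ j).toLocal (Sum.inr v)) 1)
        (fun j ↦ ContinuousRep.cohomologyMap (((W.eisensteinTower κ hm).ρ (j + 1)).toLocal (Sum.inr v))
          (((W.eisensteinTower κ hm).ρ j).toLocal (Sum.inr v)) ((W.eisensteinTower κ hm).red j).toAddMonoidHom
          continuous_of_discreteTopology (fun _ z => (W.eisensteinTower κ hm).red_equivariant j _ z) 1),
      ∀ j, ∀ η ∈ Tower.saturatedFamilies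
          (H := fun j ↦ galoisCohomology ((cd.twist ((W.eisensteinTower κ hm).ρ j)).toLocal (Sum.inr v)) 1)
          (fun j ↦ ContinuousRep.cohomologyMap ((cd.twist ((W.eisensteinTower κ hm).ρ (j + 1))).toLocal (Sum.inr v))
            ((cd.twist ((W.eisensteinTower κ hm).ρ j)).toLocal (Sum.inr v)) ((W.eisensteinTower κ hm).red j).toAddMonoidHom
            continuous_of_discreteTopology (fun _ z => (W.eisensteinTower κ hm).red_equivariant j _ z) 1) p C',
        (D j).localCup (Sum.inr v) (ξ j - p ^ (k + 1) • x'' j) (η j) = 0 := by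
  letI := IwasawaAlgebra.isLocalRing_quotient_X_pow_add_C p hm
  have hpp := hp.out
  have hpK : (p : K) ≠ 0 := by exact_mod_cast hpp.ne_zero
  -- finiteness of the levels
  haveI : ∀ j, Finite (geomTorsion (W.baseChange K) ((p : ℤ) ^ j)) := fun j ↦
    finite_torsionPoints_holds (W.baseChange K) (AlgebraicClosure K) (pow_ne_zero _ (Int.natCast_ne_zero.mpr hpp.ne_zero))
  haveI hfinX : ∀ j, Finite (galoisCohomology (((W.eisensteinTower κ hm).ρ j).toLocal (Sum.inr v)) 1) := fun j ↦ by
    haveI : Finite (EisensteinLevel p m (fun j ↦ geomTorsion (W.baseChange K) ((p : ℤ) ^ j)) (j + 1)) :=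
      IwasawaAlgebra.EisensteinCoeff.finite_twisted (p := p) (k := j + 1) (M := geomTorsion (W.baseChange K) ((p : ℤ) ^ (j + 1))) hm
    exact finite_galoisCohomology_one_toLocal _ v
  haveI hfinY : ∀ j, Finite (galoisCohomology ((cd.twist ((W.eisensteinTower κ hm).ρ j)).toLocal (Sum.inr v)) 1) := fun j ↦ by
    haveI : Finite (EisensteinLevel p m (fun j ↦ geomTorsion (W.baseChange K) ((p : ℤ) ^ j)) (j + 1)) :=
      IwasawaAlgebra.EisensteinCoeff.finite_twisted (p := p) (k := j + 1) (M := geomTorsion (W.baseChange K) ((p : ℤ) ^ (j + 1))) hm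
    exact finite_galoisCohomology_one_toLocal _ v
  haveI : ∀ j, NeZero (p ^ (j + 1)) := fun j ↦ ⟨pow_ne_zero _ hpp.ne_zero⟩
  -- the scalars `g ∈ Λ` acting by `H¹([g] ·)` on the twisted side and `H²([g] ·)`
  letI instY : ∀ j, SMul (IwasawaAlgebra p) (galoisCohomology ((cd.twist ((W.eisensteinTower κ hm).ρ j)).toLocal (Sum.inr v)) 1) :=
    fun j ↦ ⟨fun g y ↦ galoisCohomology.scalarMapH1 ((cd.twist ((W.eisensteinTower κ hm).ρ j)).toLocal (Sum.inr v))
      (DualityDatum.isScalarLinear_twist_toLocal cd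
        (κ.isScalarLinear_eisensteinAdicTowerSucc_coeff (fun j ↦ (W.baseChange K).torsionGaloisModule ((p : ℤ) ^ j))
          (fun j ↦ (W.baseChange K).torsionGaloisModuleReduce p j) hm
          (fun j ↦ (W.baseChange K).torsionGaloisModuleReduce_surjective p j) j) (Sum.inr v)) (Ideal.Quotient.mk _ g) y⟩
  letI instQ : ∀ j, SMul (IwasawaAlgebra p) (galoisCohomology ((D j).twistOne.toLocal (Sum.inr v)) 2) :=
    fun j ↦ ⟨fun g q ↦ galoisCohomology.scalarMap ((D j).twistOne.toLocal (Sum.inr v))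
      (DualityDatum.isScalarLinear_toLocal (D j).isScalarLinear_twistOne (Sum.inr v)) 2 (Ideal.Quotient.mk _ g) q⟩
  -- the readings (both adjoints)
  obtain ⟨lamQ, hlamQ⟩ := W.eisensteinTower_localCup_towerReadings_both κ hm cd D hPT v
  -- the value maps `ι_i : A_{m,i+1} → A_{m,k+2+i}`, `ι_i ∘ reduce = p^{k+1} ·`
  have hki : ∀ i : ℕ, i + 1 ≤ k + 1 + i + 1 := fun i ↦ by omega
  choose ιmod hιmod using fun i ↦ IwasawaAlgebra.EisensteinCoeff.exists_addMonoidHom_apply_reduce_eq_pow_smul (p := p) m (hki i)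
  have hι₁ : ∀ (i : ℕ) (x : IwasawaAlgebra.EisensteinCoeff p m (k + 1 + i + 1)),
      ιmod i (IwasawaAlgebra.EisensteinCoeff.reduce p m (hki i) x) = p ^ (k + 1 + i - i) • x := fun i x ↦ by
    rw [hιmod, Nat.succ_sub_succ]
  have hι₂ : ∀ (i : ℕ) (x : IwasawaAlgebra.EisensteinCoeff p m (k + 1 + i + 1)),
      ιmod i (IwasawaAlgebra.EisensteinCoeff.reduce p m (hki i) x) = p ^ (k + 1) • x := fun i x ↦ by
    rw [hι₁, Nat.add_sub_cancel]
  -- the two-index maps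
  let F := (W.baseChange K).eisensteinTwistTorsionTransfer κ hm
    (fun j ↦ (W.baseChange K).torsionGaloisModuleReduce p j) (W.torsionGaloisModuleReduce_coe (K := K) (p := p))
  obtain ⟨x'', hx'', h⟩ := Tower.exists_sub_pow_smul_forall_pairing_eq_zero
    (X := fun j ↦ galoisCohomology ((cd.twist ((W.eisensteinTower κ hm).ρ j)).toLocal (Sum.inr v)) 1)
    (fun j ↦ ContinuousRep.cohomologyMap ((cd.twist ((W.eisensteinTower κ hm).ρ (j + 1))).toLocal (Sum.inr v))
      ((cd.twist ((W.eisensteinTower κ hm).ρ j)).toLocal (Sum.inr v)) ((W.eisensteinTower κ hm).red j).toAddMonoidHom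
      continuous_of_discreteTopology (fun _ z => (W.eisensteinTower κ hm).red_equivariant j _ z) 1)
    (Y := fun j ↦ galoisCohomology (((W.eisensteinTower κ hm).ρ j).toLocal (Sum.inr v)) 1)
    (fun j ↦ ContinuousRep.cohomologyMap (((W.eisensteinTower κ hm).ρ (j + 1)).toLocal (Sum.inr v))
      (((W.eisensteinTower κ hm).ρ j).toLocal (Sum.inr v)) ((W.eisensteinTower κ hm).red j).toAddMonoidHom
      continuous_of_discreteTopology (fun _ z => (W.eisensteinTower κ hm).red_equivariant j _ z) 1)
    (Q := fun j ↦ galoisCohomology ((D j).twistOne.toLocal (Sum.inr v)) 2)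
    (fun j ↦ ContinuousRep.cohomologyMap ((D (j + 1)).twistOne.toLocal (Sum.inr v)) ((D j).twistOne.toLocal (Sum.inr v))
      (IwasawaAlgebra.EisensteinCoeff.reduce p m (Nat.le_succ (j + 1))).toAddMonoidHom
      continuous_of_discreteTopology (fun _ z => W.reduce_twistOne κ hm cd D j _ z) 2)
    (fun j ↦ ((D j).localCup (Sum.inr v)).flip) p C'
    (fun j y x ↦ W.eisensteinTower_localCup_red κ hm cd D he_red j (Sum.inr v) x y)
    (S := IwasawaAlgebra p) (fun j ↦ p ^ (j + 1))
    (fun j y ↦ W.eisensteinTower_twist_toLocal_pow_nsmul_eq_zero κ hm cd j (Sum.inr v) y)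
    lamQ (fun j χ ↦ (hlamQ j).2.1 χ)
    (fun j q q' hq ↦ (hlamQ j).2.2 q q' fun r ↦ by
      obtain ⟨g, rfl⟩ := Ideal.Quotient.mk_surjective r
      exact hq g)
    (fun j g y x ↦ (D j).localCup_scalarMapH1_right (Sum.inr v)
      (DualityDatum.isScalarLinear_toLocal
        (κ.isScalarLinear_eisensteinAdicTowerSucc_coeff (fun j ↦ (W.baseChange K).torsionGaloisModule ((p : ℤ) ^ j))
          (fun j ↦ (W.baseChange K).torsionGaloisModuleReduce p j) hm
          (fun j ↦ (W.baseChange K).torsionGaloisModuleReduce_surjective p j) j) (Sum.inr v))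
      (DualityDatum.isScalarLinear_twist_toLocal cd
        (κ.isScalarLinear_eisensteinAdicTowerSucc_coeff (fun j ↦ (W.baseChange K).torsionGaloisModule ((p : ℤ) ^ j))
          (fun j ↦ (W.baseChange K).torsionGaloisModuleReduce p j) hm
          (fun j ↦ (W.baseChange K).torsionGaloisModuleReduce_surjective p j) j) (Sum.inr v))
      (Ideal.Quotient.mk _ g) x y)
    (fun g η hη ↦ Tower.map_mem_saturatedFamilies _ p C'
      (fun j ↦ galoisCohomology.scalarMapH1 ((cd.twist ((W.eisensteinTower κ hm).ρ j)).toLocal (Sum.inr v))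
        (DualityDatum.isScalarLinear_twist_toLocal cd
          (κ.isScalarLinear_eisensteinAdicTowerSucc_coeff (fun j ↦ (W.baseChange K).torsionGaloisModule ((p : ℤ) ^ j))
            (fun j ↦ (W.baseChange K).torsionGaloisModuleReduce p j) hm
            (fun j ↦ (W.baseChange K).torsionGaloisModuleReduce_surjective p j) j) (Sum.inr v)) (Ideal.Quotient.mk _ g))
      (fun j y ↦ by
        have h := W.eisensteinTower_red_scalarMapH1_twist κ hm cd (Sum.inr v) j (Ideal.Quotient.mk _ g) y
        rw [IwasawaAlgebra.EisensteinCoeff.reduce_mk] at h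
        exact h)
      (fun j y hy ↦ hC' j _ y hy) hη)
    (fun δ hδ i hδi ↦ W.eisensteinTower_exists_forall_eq_pow_smul_of_apply_eq_zero_twist κ hm cd v hδ i hδi) k
    (fun i ↦ ContinuousRep.cohomologyMap ((D i).twistOne.toLocal (Sum.inr v)) ((D (k + 1 + i)).twistOne.toLocal (Sum.inr v))
      (ιmod i) continuous_of_discreteTopology
      (fun _ z => (D i).twistOne_apply_of_apply_reduce (D (k + 1 + i)) (hki i) (ιmod i) (p ^ (k + 1)) (hι₂ i) _ z) 2)
    (fun i ↦ DualityDatum.cohomologyMap_two_injective_of_apply_reduce hm (hki i) (D i) (D (k + 1 + i)) (ιmod i) (hιmod i)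
      (Sum.inr v))
    (fun i g q ↦ W.eisensteinTower_valueMap_scalarMap κ hm cd D (hki i) (ιmod i) (k + 1) (hι₂ i) (Sum.inr v) g q)
    (fun i q ↦ W.eisensteinTower_valueMap_red κ hm cd D (k + 1) (hki (i + 1)) (ιmod (i + 1)) (hι₂ (i + 1)) (hki i) (ιmod i)
      (hι₂ i) (Sum.inr v) q)
    (fun i q hq ↦ W.eisensteinTower_valueMap_range κ hm cd D hPT v k i (hki i) (ιmod i) (hι₂ i) q hq)
    (fun i ↦ galoisCohomology.map (DiscreteGaloisModule.localMap (DiscreteGaloisModule.restrictMap (F (k + 1) (k + 1 + i + 1))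
      cd.conj) (Sum.inr v)) 1)
    (fun i ↦ galoisCohomology.map (DiscreteGaloisModule.localMap (F (k + 1 + i + 1) (k + 1)) (Sum.inr v)) 1)
    (fun i η hη ↦ by
      have h := W.eisensteinTower_pow_smul_apply_eq_map_transfer_twist κ hm cd (Sum.inr v) (show k ≤ k + 1 + i by omega) hη
      rwa [show k + 1 + i - k = i + 1 by omega] at h)
    (fun i ξ' hξ' ↦ W.eisensteinTower_map_transfer_apply_of_mem_compatibleFamilies κ hm (Sum.inr v)
      (show k ≤ k + 1 + i by omega) hξ')
    (fun i y x' h0 ↦ W.eisensteinTower_localCup_transfer_eq_zero_of_eq_zero_left κ hm cd D he_red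
      (show k ≤ k + 1 + i by omega) (Sum.inr v) x' y h0)
    (fun i ↦ galoisCohomology.map (DiscreteGaloisModule.localMap (DiscreteGaloisModule.restrictMap (F (i + 1) (k + 1 + i + 1))
      cd.conj) (Sum.inr v)) 1)
    (fun i ↦ galoisCohomology.map (DiscreteGaloisModule.localMap (F (k + 1 + i + 1) (i + 1)) (Sum.inr v)) 1)
    (fun i η hη ↦ by
      have h := W.eisensteinTower_pow_smul_apply_eq_map_transfer_twist κ hm cd (Sum.inr v) (Nat.le_add_left i (k + 1)) hη
      rwa [Nat.add_sub_cancel] at h)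
    (fun i ξ' hξ' ↦ W.eisensteinTower_map_transfer_apply_of_mem_compatibleFamilies κ hm (Sum.inr v)
      (Nat.le_add_left i (k + 1)) hξ')
    (fun i y x' ↦ (W.eisensteinTower_localCup_transfer_adjoint_left' κ hm cd D he_red (Nat.le_add_left i (k + 1)) (Sum.inr v)
      (ιmod i) (hι₁ i) x' y).symm)
    ξ hξ hξ0
  exact ⟨x'', hx'', h⟩

end WeierstrassCurve

end
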